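import Literature.Topology.FourManifolds.CutRankCount
import Literature.Topology.FourManifolds.KnotComplementHomology
import Literature.Topology.FourManifolds.CutHomologyVanishing
import HarnessLib

/-!
# The difference of the two push-offs is an isomorphism `H₁(F) ≅ H₁(S³ ∖ F)`

Topic `Literature/Topology/FourManifolds`; a consequence of the Mayer–Vietoris computation of
`CutRankCount.lean` recorded for the Seifert-form programme (`SliceKnotsFoxMilnorPairing.lean`).
For a circle-valued map `f : X → S¹` with a band `N ≃ L × (-1, 1)` about the connected cut
`L = {f = 1}` trivialised over the angle (`CircleBandData f`), sides `N±`, `Y = {f ≠ 1}`, and the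
maps `i± : Hₙ(N±) → Hₙ(Y)`, `j± : Hₙ(N±) ≅ Hₙ(N)` induced by the inclusions:

* `CutData.pushoffPair_bijective` — if `Hₙ₊₁(X) = 0` and `Hₙ(Y) → Hₙ(X)`, `Hₙ(N) → Hₙ(X)` vanish,
  then `(p, q) ↦ (i₊ p + i₋ q, j₊ p + j₋ q) : Hₙ(N₊) × Hₙ(N₋) → Hₙ(Y) × Hₙ(N)` is bijective (it is
  the composite of the two Mayer–Vietoris bijections `sideMap` and `toProd` of `CutRankCount.lean`);
* `CircleBandData.bijective_iPlus'_sub_iMinus'` — hence, with `i±' = i± ∘ j±⁻¹ : Hₙ(N) → Hₙ(Y)`,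
  **the difference of the two push-offs `i₊' − i₋' : Hₙ(N) → Hₙ(Y)` is an isomorphism**
  (`CircleBandData.pushoffDiffEquiv`);
* `Knot.TubularNbhd.bijective_pushoffDiff` — for a knot complement and a band of a Seifert surface
  along which the meridian winds once, unconditionally in degree `1`
  (`Knot.isZero_singularHomology_complement`, `CircleBandData.map_subsetIncl_Y_eq_zero`): the
  classical statement that for a Seifert matrix `V` the matrix `Vᵀ − V` of `i₊' − i₋'` in dual bases —
  the intersection form of the Seifert surface — is unimodular, equivalently `Δ_K(1) = ±1`
  (Rolfsen 1976, §8.C, 8.C.7; Lickorish 1997, proof of Thm. 6.10; Kauffman 1987, Ch. VII).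

Everything is proved; no named fact is introduced.

## References

* D. Rolfsen, *Knots and Links*, Publish or Perish (1976), §5.C, §8.C. [Rolfsen1976]
* W. B. R. Lickorish, *An Introduction to Knot Theory*, GTM 175 (1997), Ch. 6 (Thm. 6.10). [Lickorish1997]
* A. Hatcher, *Algebraic Topology* (2002), §2.2 (Mayer–Vietoris). [HatcherAT2002]
-/

noncomputable section

open Set Function CategoryTheory Limits
open scoped Real Topology
open Literature.AlgebraicTopology.SingularHomology

universe u

namespace Literature.Topology.FourManifolds

namespace CircleMaps

namespace CyclicCover

variable {X : Type u} [TopologicalSpace X] {f : C(X, Circle)}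

namespace CutData

variable (D : CutData f)
variable (R : Type) [CommRing R] (M : Type) [AddCommGroup M] [Module R M]

/-! ### The two Mayer–Vietoris bijections composed -/

/-- Composite of inclusions through `Y ∩ N`, `Y` side, plus. [folklore] -/
theorem map_inter_left_map_plus (n : ℕ) (p : singularHomology R M ↥D.plus n) :
    singularHomology.map R M (subsetInclusion (inter_subset_left : D.Y ∩ D.N ⊆ D.Y)) n
      (singularHomology.map R M (subsetInclusion D.plus_subset_inter) n p) = D.iPlus R M n p := by
  rw [← ModuleCat.comp_apply, ← singularHomology.map_comp]; rfl

/-- Composite of inclusions through `Y ∩ N`, `Y` side, minus. [folklore] -/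
theorem map_inter_left_map_minus (n : ℕ) (q : singularHomology R M ↥D.minus n) :
    singularHomology.map R M (subsetInclusion (inter_subset_left : D.Y ∩ D.N ⊆ D.Y)) n
      (singularHomology.map R M (subsetInclusion D.minus_subset_inter) n q) = D.iMinus R M n q := by
  rw [← ModuleCat.comp_apply, ← singularHomology.map_comp]; rfl

/-- Composite of inclusions through `Y ∩ N`, `N` side, plus. [folklore] -/
theorem map_inter_right_map_plus (n : ℕ) (p : singularHomology R M ↥D.plus n) :
    singularHomology.map R M (subsetInclusion (inter_subset_right : D.Y ∩ D.N ⊆ D.N)) n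
      (singularHomology.map R M (subsetInclusion D.plus_subset_inter) n p) = D.jPlus R M n p := by
  rw [← ModuleCat.comp_apply, ← singularHomology.map_comp]; rfl

/-- Composite of inclusions through `Y ∩ N`, `N` side, minus. [folklore] -/
theorem map_inter_right_map_minus (n : ℕ) (q : singularHomology R M ↥D.minus n) :
    singularHomology.map R M (subsetInclusion (inter_subset_right : D.Y ∩ D.N ⊆ D.N)) n
      (singularHomology.map R M (subsetInclusion D.minus_subset_inter) n q) = D.jMinus R M n q := by
  rw [← ModuleCat.comp_apply, ← singularHomology.map_comp]; rfl

/-- `toProd (sideMap (p, q)) = (i₊ p + i₋ q, j₊ p + j₋ q)`. [folklore] -/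
theorem toProd_sideMap (n : ℕ) (p : singularHomology R M ↥D.plus n) (q : singularHomology R M ↥D.minus n) :
    D.toProd R M n (D.sideMap R M n (p, q)) =
      (D.iPlus R M n p + D.iMinus R M n q, D.jPlus R M n p + D.jMinus R M n q) := by
  rw [sideMap_apply, map_add]
  refine Prod.ext ?_ ?_
  · change singularHomology.map R M _ n _ + singularHomology.map R M _ n _ = _
    rw [D.map_inter_left_map_plus, D.map_inter_left_map_minus]
  · change singularHomology.map R M _ n _ + singularHomology.map R M _ n _ = _
    rw [D.map_inter_right_map_plus, D.map_inter_right_map_minus]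

/-- **`(p, q) ↦ (i₊ p + i₋ q, j₊ p + j₋ q)` is bijective** under the Mayer–Vietoris hypotheses
(`Hₙ₊₁(X) = 0`, `Hₙ(Y) → Hₙ(X) = 0`, `Hₙ(N) → Hₙ(X) = 0`). [cite: HatcherAT2002, §2.2] -/
theorem pushoffPair_bijective (n : ℕ) (h2 : IsZero (singularHomology R M X (n + 1)))
    (hY : singularHomology.map R M (subsetIncl D.Y) n = 0)
    (hN : singularHomology.map R M (subsetIncl D.N) n = 0) :
    Bijective fun pq : singularHomology R M ↥D.plus n × singularHomology R M ↥D.minus n =>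
      (D.iPlus R M n pq.1 + D.iMinus R M n pq.2, D.jPlus R M n pq.1 + D.jMinus R M n pq.2) := by
  have h : (fun pq : singularHomology R M ↥D.plus n × singularHomology R M ↥D.minus n =>
      (D.iPlus R M n pq.1 + D.iMinus R M n pq.2, D.jPlus R M n pq.1 + D.jMinus R M n pq.2)) =
      D.toProd R M n ∘ D.sideMap R M n := by
    funext pq
    obtain ⟨p, q⟩ := pq
    exact (D.toProd_sideMap R M n p q).symm
  rw [h]
  exact (D.toProd_bijective R M n h2 hY hN).comp (D.sideMap_bijective R M n)

end CutData

/-! ### The difference of the push-offs -/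

namespace CircleBandData

variable (B : CircleBandData f)
variable (R : Type) [CommRing R] (M : Type) [AddCommGroup M] [Module R M]

/-- `j₊` as a linear isomorphism `Hₙ(N₊) ≃ Hₙ(N)`. [folklore] -/
def jPlusEquiv (n : ℕ) : singularHomology R M ↥B.cutData.plus n ≃ₗ[R] singularHomology R M ↥B.cutData.N n :=
  LinearEquiv.ofBijective (B.cutData.jPlus R M n).hom (B.jPlus_bijective R M n)

/-- `j₋` as a linear isomorphism `Hₙ(N₋) ≃ Hₙ(N)`. [folklore] -/
def jMinusEquiv (n : ℕ) : singularHomology R M ↥B.cutData.minus n ≃ₗ[R] singularHomology R M ↥B.cutData.N n :=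
  LinearEquiv.ofBijective (B.cutData.jMinus R M n).hom (B.jMinus_bijective R M n)

/-- `jPlusEquiv` is `j₊`. [folklore] -/
@[simp] theorem jPlusEquiv_apply (n : ℕ) (p : singularHomology R M ↥B.cutData.plus n) :
    B.jPlusEquiv R M n p = B.cutData.jPlus R M n p := rfl

/-- `jMinusEquiv` is `j₋`. [folklore] -/
@[simp] theorem jMinusEquiv_apply (n : ℕ) (q : singularHomology R M ↥B.cutData.minus n) :
    B.jMinusEquiv R M n q = B.cutData.jMinus R M n q := rfl

/-- **The positive push-off on `Hₙ(N)`**: `i₊' = i₊ ∘ j₊⁻¹`. [cite: Rolfsen1976, §5.C] -/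
def iPlus' (n : ℕ) : singularHomology R M ↥B.cutData.N n →ₗ[R] singularHomology R M ↥B.cutData.Y n :=
  (B.cutData.iPlus R M n).hom ∘ₗ (B.jPlusEquiv R M n).symm.toLinearMap

/-- **The negative push-off on `Hₙ(N)`**: `i₋' = i₋ ∘ j₋⁻¹`. [cite: Rolfsen1976, §5.C] -/
def iMinus' (n : ℕ) : singularHomology R M ↥B.cutData.N n →ₗ[R] singularHomology R M ↥B.cutData.Y n :=
  (B.cutData.iMinus R M n).hom ∘ₗ (B.jMinusEquiv R M n).symm.toLinearMap

/-- `i₊' (j₊ p) = i₊ p`. [folklore] -/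
theorem iPlus'_jPlus (n : ℕ) (p : singularHomology R M ↥B.cutData.plus n) :
    B.iPlus' R M n (B.cutData.jPlus R M n p) = B.cutData.iPlus R M n p := by
  change (B.cutData.iPlus R M n).hom ((B.jPlusEquiv R M n).symm (B.jPlusEquiv R M n p)) = _
  rw [LinearEquiv.symm_apply_apply]

/-- `i₋' (j₋ q) = i₋ q`. [folklore] -/
theorem iMinus'_jMinus (n : ℕ) (q : singularHomology R M ↥B.cutData.minus n) :
    B.iMinus' R M n (B.cutData.jMinus R M n q) = B.cutData.iMinus R M n q := by
  change (B.cutData.iMinus R M n).hom ((B.jMinusEquiv R M n).symm (B.jMinusEquiv R M n q)) = _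
  rw [LinearEquiv.symm_apply_apply]

/-- **`i₊' − i₋'` is bijective** under the Mayer–Vietoris hypotheses. Injectivity: if
`i₊' c = i₋' c` then `(j₊⁻¹ c, -j₋⁻¹ c) ↦ (0, 0)`, so `c = 0`; surjectivity: `y = i₊ p + i₋ q` with
`j₊ p + j₋ q = 0` gives `y = (i₊' − i₋') (j₊ p)`. [cite: Rolfsen1976, §8.C] -/
theorem bijective_iPlus'_sub_iMinus' (n : ℕ) (h2 : IsZero (singularHomology R M X (n + 1)))
    (hY : singularHomology.map R M (subsetIncl B.cutData.Y) n = 0)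
    (hN : singularHomology.map R M (subsetIncl B.cutData.N) n = 0) :
    Bijective (B.iPlus' R M n - B.iMinus' R M n) := by
  have hpair := B.cutData.pushoffPair_bijective R M n h2 hY hN
  constructor
  · rw [injective_iff_map_eq_zero]
    intro c hc
    rw [LinearMap.sub_apply, sub_eq_zero] at hc
    set p := (B.jPlusEquiv R M n).symm c with hp
    set q := -((B.jMinusEquiv R M n).symm c) with hq
    have hjp : B.cutData.jPlus R M n p = c := by
      rw [hp, ← jPlusEquiv_apply, LinearEquiv.apply_symm_apply]
    have hjq : B.cutData.jMinus R M n q = -c := by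
      rw [hq, map_neg, ← jMinusEquiv_apply, LinearEquiv.apply_symm_apply]
    have h0 : (B.cutData.iPlus R M n p + B.cutData.iMinus R M n q,
        B.cutData.jPlus R M n p + B.cutData.jMinus R M n q) = (0, 0) := by
      refine Prod.ext ?_ ?_
      · change B.cutData.iPlus R M n p + B.cutData.iMinus R M n q = 0
        rw [← B.iPlus'_jPlus R M n p, ← B.iMinus'_jMinus R M n q, hjp, hjq, map_neg, hc, add_neg_cancel]
      · change B.cutData.jPlus R M n p + B.cutData.jMinus R M n q = 0
        rw [hjp, hjq, add_neg_cancel]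
    have h00 : ((0 : singularHomology R M ↥B.cutData.plus n), (0 : singularHomology R M ↥B.cutData.minus n)) =
        (p, q) := hpair.1 (by simp only [map_zero, add_zero]; exact h0.symm)
    have hp0 : p = 0 := (Prod.ext_iff.1 h00).1.symm
    rw [← hjp, hp0, map_zero]
  · intro y
    obtain ⟨⟨p, q⟩, hpq⟩ := hpair.2 (y, 0)
    obtain ⟨hy, hj⟩ := Prod.ext_iff.1 hpq
    change B.cutData.iPlus R M n p + B.cutData.iMinus R M n q = y at hy
    change B.cutData.jPlus R M n p + B.cutData.jMinus R M n q = 0 at hj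
    refine ⟨B.cutData.jPlus R M n p, ?_⟩
    have hj' : B.cutData.jPlus R M n p = -B.cutData.jMinus R M n q := eq_neg_of_add_eq_zero_left hj
    rw [LinearMap.sub_apply, B.iPlus'_jPlus, hj', map_neg, B.iMinus'_jMinus, sub_neg_eq_add, hy]

/-- **The difference of the push-offs as a linear isomorphism `Hₙ(N) ≃ Hₙ(Y)`.**
[cite: Rolfsen1976, §8.C] -/
def pushoffDiffEquiv (n : ℕ) (h2 : IsZero (singularHomology R M X (n + 1)))
    (hY : singularHomology.map R M (subsetIncl B.cutData.Y) n = 0)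
    (hN : singularHomology.map R M (subsetIncl B.cutData.N) n = 0) :
    singularHomology R M ↥B.cutData.N n ≃ₗ[R] singularHomology R M ↥B.cutData.Y n :=
  LinearEquiv.ofBijective _ (B.bijective_iPlus'_sub_iMinus' R M n h2 hY hN)

end CircleBandData

end CyclicCover

end CircleMaps

/-! ### For a knot -/

namespace Knot.TubularNbhd

open CircleMaps CircleMaps.CyclicCover

variable {K : Knot} (ν : Knot.TubularNbhd K)

/-- **For a knot, `i₊' − i₋' : H₁(N) → H₁(S³ ∖ F̄)` is an isomorphism** for every band of a
Seifert surface along which the meridian winds once (the intersection form `Vᵀ − V` of a Seifert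
surface is unimodular; Rolfsen 1976, §8.C; Lickorish 1997, proof of Thm. 6.10).
[cite: Rolfsen1976, §8.C] [cite: Lickorish1997, Thm. 6.10] -/
theorem bijective_pushoffDiff (f : C(K.complement, Circle)) (B : CircleBandData f)
    (h₀ : winding f ν.meridian = 1) :
    Bijective (B.iPlus' ℤ ℤ 1 - B.iMinus' ℤ ℤ 1) := by
  have hinj := ν.injective_map_of_winding_meridian f h₀
  exact B.bijective_iPlus'_sub_iMinus' ℤ ℤ 1 (K.isZero_singularHomology_complement ℤ ℤ le_rfl)
    (B.map_subsetIncl_Y_eq_zero ℤ ℤ hinj) (B.map_subsetIncl_N_eq_zero ℤ ℤ hinj)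

end Knot.TubularNbhd

end Literature.Topology.FourManifolds
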